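import Literature.NumberTheory.Automorphic.UnitaryGroupOfLocalCovolumeStableKit
import Literature.NumberTheory.Automorphic.UnitaryGroupAbsorbedFamilyStableWeight
import Literature.NumberTheory.Automorphic.UnitaryGroupOrbitalMeasureFamilyOfLocal
import HarnessLib

/-!
# The ABSORBED adelic orbital family of the anisotropic `U(H)` keyed to `ofLocal` at EVERY rational class, with STABLE-CLASS weights:
# `μA c = α(𝒪_st(c)) • ofLocal mG mGi c` for all `c` (regular classes: the (O10-c4) covolume head; non-regular classes: the stability letter `hstab_s`)
(Rogawski (1990), §14.5 pp. 237–239, §5.4 (5.4.1) p. 72, Prop. 10.1.2; Kottwitz (1988), Thm. 1; Deitmar–Echterhoff (2014), Thm. 1.5.3)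

Topic `NumberTheory/Automorphic`; namespace `Literature.NumberTheory.Automorphic.UnitaryGroup`; THEOREMS ONLY (no definition, no instance, no named
fact, no `sorry`).  Cell `pub/hodgecm-mathlib`, ENGINE T1 line `F0_T1InnerFormTraceIdentity` (crux item stmt-HodgeConjecture-24833), row **(A-s) «the ED 1.24
anchor leaf»** (F0P3a-plan (g5) PLACEMENT 2026-08-31T11:05:46Z): the ALL-CLASSES successor of the T1 line's `exists_absorbedAdelicFamily_ofLocal` (MAIN, regular
classes, weight `∃ b > 0`), MAIN-free, over ★ (O10-c5) `exists_absorbedFamily_stableCovolWeight` (whose class predicate `R` is arbitrary) and ★ (O10-c4) HEAD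
`covol_ofLocal_eq_of_isRegular_of_ofConjClass_eq` (covolume weights of `ofLocal` are constant on the REGULAR stable classes).

THE STATEMENT.  Data = the (c4) HEAD's, token for token (`hanis hH hHd ν hK mG hcan mGi νGi t' hW hC hadmA νA`), the automorphic measure `μ`, and THREE
ALL-CLASSES riders on the kit's local ∕ archimedean families — `hadm` (the member of `mG v` at `⟦(γ_c)_v⟧` is non-zero, invariant, finite on compacta at
EVERY rational class `c`, `γ_c = out c`), `hadmA′` (idem `mGi` at `⟦(γ_c)_∞⟧`), `hnorm` (`∃ S₀, IsNormalisedOff L N H mG (γ_c ⊗ 1) S₀` at every `c`) — at the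
regular classes these are pins (ix)∕(xi‴) of the line (★ `exists_isNormalisedOff_of_isCanonical`), at the non-regular classes they are what the (ANCHOR-s)
certificate ∕ ★ `UnitaryGroupLocalCentralizerMeasureSemisimple` (ED. 2) deliver for the PATCHED families — this leaf does not choose the singular members, it
takes `mG, mGi` as given; plus ONE letter **`hstab_s`**: the `hstab` hypothesis of ★ (c5) RESTRICTED to pairs of NON-regular classes, for
`m := AdelicOrbitalMeasureFamily.ofLocal L N H mG mGi`.  THEN (★ (c5) with `R := ⊤`): ONE all-class-admissible family `μA` with `Φ_{μA}(·, F)` finitely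
supported, the weight-free O-expansion `θ_{G′}(F) = Σᶠ_{𝒪_st} 𝒪_st.orbitalSum (Φ_{μA}(·, F))`, and a POSITIVE `α` on the stable classes with
`μA c = α(𝒪_st(c)) • ofLocal L N H mG mGi c` for EVERY rational class `c` — the anchor discharge of pins (viii′)(viii″)(viii⁗) + (viii⁵)∕(viii⁵-s) of ED 1.24.

HONESTY NOTE on `hstab_s` (F0P3a-p06 (g5) census 2026-08-31T11:08Z).  `a(c) · Φ_{m c}` is choice-free, but the covolume `a(c)` ALONE is constant on a
SINGULAR stable class only for TRANSFER-COMPATIBLE centraliser measures (print: Tamagawa ∕ `|ω|_v` measures, [Rogawski1990, §1.7, §4.3],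
[LanglandsShelstad1987, (1.4)], [Kottwitz1988, Thm. 1]).  At a regular class compatibility is automatic (stably conjugate tori are `F`-isomorphic and the
compact-core normalisation transports — ★ (O10-c4-b)); at a singular class the centralisers of two rational classes of one stable class are in general
NON-isomorphic inner forms (`U(W_a) × U(1)` vs `U(W′_a) × U(1)`), so `hstab_s` is a genuine hypothesis on HOW the kit normalises its singular local members
(level-normalised members must be rescaled by per-local-class constants to be compatible); this leaf is agnostic to that choice.

* **`UnitaryGroup.exists_absorbedFamily_ofLocal_stableCovolWeight`** — the head.
HC_CM is proved only modulo the printed citations until rung 0 closes; this file proves no printed citation.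

## References
* J. D. Rogawski, *Automorphic Representations of Unitary Groups in Three Variables* (1990), §5.4 (5.4.1) p. 72, Prop. 10.1.2, §14.5 pp. 237–239
  [Rogawski1990].
* R. E. Kottwitz, *Tamagawa numbers*, Ann. of Math. 127 (1988), Thm. 1 [Kottwitz1988].
* R. P. Langlands, D. Shelstad, *On the definition of transfer factors*, Math. Ann. 278 (1987), §1.3–§1.4 [LanglandsShelstad1987].
* A. Deitmar, S. Echterhoff, *Principles of Harmonic Analysis* (2nd ed. 2014), Thm. 1.5.3 [DeitmarEchterhoff2014].
-/

set_option autoImplicit false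

noncomputable section

open _root_.MeasureTheory _root_.MeasureTheory.Measure Set Filter Function NumberField IsDedekindDomain
open _root_.Topology
open Literature.MeasureTheory.Group Literature.NumberTheory.Rogawski1990
open scoped ENNReal NNReal Matrix

namespace Literature.NumberTheory.Automorphic

namespace UnitaryGroup

open CompactlySupported
open Literature.AlgebraicGeometry.ShimuraVarieties (hermForm)

section Head

variable (L : Type) [Field L] [NumberField L] [IsCMField L] (N : ℕ) (H : Matrix (Fin N) (Fin N) L)
  [∀ g : (cmDatum L N H).Adelic, MeasurableSpace ((cmDatum L N H).Adelic ⧸ Subgroup.centralizer ({g} : Set (cmDatum L N H).Adelic))]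
  [∀ g : (cmDatum L N H).Adelic, BorelSpace ((cmDatum L N H).Adelic ⧸ Subgroup.centralizer ({g} : Set (cmDatum L N H).Adelic))]
  [∀ a : (arch (↥(maximalRealSubfield L)) L (IsCMField.complexConj L) N H), MeasurableSpace ((arch (↥(maximalRealSubfield L)) L (IsCMField.complexConj L) N H) ⧸ Subgroup.centralizer ({a} : Set (arch (↥(maximalRealSubfield L)) L (IsCMField.complexConj L) N H)))]
  [∀ a : (arch (↥(maximalRealSubfield L)) L (IsCMField.complexConj L) N H), BorelSpace ((arch (↥(maximalRealSubfield L)) L (IsCMField.complexConj L) N H) ⧸ Subgroup.centralizer ({a} : Set (arch (↥(maximalRealSubfield L)) L (IsCMField.complexConj L) N H)))]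
  [∀ (v : HeightOneSpectrum (𝓞 ↥(maximalRealSubfield L))) (x : (cmDatum L N H).Local v),
    MeasurableSpace ((cmDatum L N H).Local v ⧸ Subgroup.centralizer ({x} : Set ((cmDatum L N H).Local v)))]
  [∀ (v : HeightOneSpectrum (𝓞 ↥(maximalRealSubfield L))) (x : (cmDatum L N H).Local v),
    BorelSpace ((cmDatum L N H).Local v ⧸ Subgroup.centralizer ({x} : Set ((cmDatum L N H).Local v)))]
  [∀ v, MeasurableSpace ((cmDatum L N H).Local v)] [∀ v, BorelSpace ((cmDatum L N H).Local v)]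
  [MeasurableSpace (cmDatum L N H).Adelic] [BorelSpace (cmDatum L N H).Adelic]
  [MeasurableSpace (arch (↥(maximalRealSubfield L)) L (IsCMField.complexConj L) N H)] [BorelSpace (arch (↥(maximalRealSubfield L)) L (IsCMField.complexConj L) N H)]
  [∀ γ : (cmDatum L N H).Adelic, MeasurableSpace (↥(Subgroup.centralizer ({γ} : Set (cmDatum L N H).Adelic)) ⧸
    ((cmDatum L N H).quotientSubgroup ⊓ Subgroup.centralizer ({γ} : Set (cmDatum L N H).Adelic)).subgroupOf
      (Subgroup.centralizer ({γ} : Set (cmDatum L N H).Adelic)))]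
  [∀ γ : (cmDatum L N H).Adelic, BorelSpace (↥(Subgroup.centralizer ({γ} : Set (cmDatum L N H).Adelic)) ⧸
    ((cmDatum L N H).quotientSubgroup ⊓ Subgroup.centralizer ({γ} : Set (cmDatum L N H).Adelic)).subgroupOf
      (Subgroup.centralizer ({γ} : Set (cmDatum L N H).Adelic)))]
  [hCcl : ∀ γ : (cmDatum L N H).Adelic, IsClosed ((Subgroup.centralizer ({γ} : Set (cmDatum L N H).Adelic) :
    Subgroup (cmDatum L N H).Adelic) : Set (cmDatum L N H).Adelic)]
  [∀ γ : (cmDatum L N H).Adelic, (count : Measure ↥(((cmDatum L N H).quotientSubgroup ⊓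
    Subgroup.centralizer ({γ} : Set (cmDatum L N H).Adelic)).subgroupOf
      (Subgroup.centralizer ({γ} : Set (cmDatum L N H).Adelic)))).IsHaarMeasure]

/-- **(A-s) THE ABSORBED FAMILY KEYED TO `ofLocal` AT EVERY CLASS, STABLE-CLASS WEIGHTS.**  `H` hermitian, non-degenerate, anisotropic; the (c4) HEAD's data
`ν hK mG hcan mGi νGi t' hW hC hadmA νA`; the automorphic measure `μ`; the all-classes riders `hadm`, `hadmA′`, `hnorm` (admissibility of the local and archimedean
members and normalisation of `mG` off a finite set, at EVERY rational class); and the stability letter `hstab_s` at the pairs of NON-regular classes (the `hstab` of ★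
(c5) restricted, for `m := ofLocal mG mGi`).  THEN there are an all-class-admissible adelic family `μA` with `Φ_{μA}(·, F)` finitely supported and the weight-free
O-expansion of `diagTrace`, and a positive `α` on the stable classes with `μA c = α(𝒪_st c) • AdelicOrbitalMeasureFamily.ofLocal L N H mG mGi c` for EVERY `c`
(★ (c5) at `R := ⊤`; its `hstab` by cases: regular pairs ★ (c4) HEAD with `m := ofLocal`, `hmreg := rfl`; non-regular pairs `hstab_s`; regularity is constant on a
stable class, ★ `isRegularElt_of_isConj`). [cite: Rogawski1990, §14.5 pp. 237–239; §5.4 (5.4.1) p. 72] [cite: Kottwitz1988, Thm. 1] [cite: DeitmarEchterhoff2014, Thm. 1.5.3] -/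
theorem exists_absorbedFamily_ofLocal_stableCovolWeight
    (hanis : ∀ x : Fin N → L, hermForm (cmConjRingHom L) H x x = 0 → x = 0)
    (hH : (H.map (cmConjRingHom L))ᵀ = H) (hHd : H.det ≠ 0)
    (ν : ∀ v, Measure ((cmDatum L N H).Local v)) [∀ v, IsHaarMeasure (ν v)] [∀ v, (ν v).IsMulRightInvariant]
    (hK : ∀ v, ν v (cmLocalIntegralLevel L N H v : Set ((cmDatum L N H).Local v)) = 1)
    (mG : ∀ v : HeightOneSpectrum (𝓞 ↥(maximalRealSubfield L)), OrbitalMeasureFamily ((cmDatum L N H).Local v))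
    (hcan : ∀ v, (mG v).IsCanonical (fun x => IsRegularElt (x.val : GL (Fin N) (LocalRing L v))) (ν v))
    (mGi : OrbitalMeasureFamily (arch (↥(maximalRealSubfield L)) L (IsCMField.complexConj L) N H))
    (νGi : Measure (arch (↥(maximalRealSubfield L)) L (IsCMField.complexConj L) N H)) [IsFiniteMeasureOnCompacts νGi] [νGi.IsMulRightInvariant]
    (t' : ∀ γ' : arch (↥(maximalRealSubfield L)) L (IsCMField.complexConj L) N H, Measure (Subgroup.centralizer ({γ'} : Set _)))
    (hW : mGi.IsQuotientOf (fun γ => IsRegularElt (γ.val : GL (Fin N) (mixedEmbedding.mixedSpace L))) νGi t')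
    (hC : ∀ (γ₁ γ₂ : arch (↥(maximalRealSubfield L)) L (IsCMField.complexConj L) N H)
        (h₁ : IsRegularElt (γ₁.val : GL (Fin N) (mixedEmbedding.mixedSpace L)))
        (hc : Corresponds (conjMixed (↥(maximalRealSubfield L)) L (IsCMField.complexConj L)) (archFormOf L N H) (archFormOf L N H) γ₁ γ₂),
        Measure.map (archStableCentralizerEquiv L hHd hHd hc h₁) (t' γ₁) = t' γ₂)
    (hadmA : mGi.IsAdmissibleOn (fun γ => IsRegularElt (γ.val : GL (Fin N) (mixedEmbedding.mixedSpace L))))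
    (νA : Measure (cmDatum L N H).Adelic) [νA.IsHaarMeasure] [νA.IsMulRightInvariant]
    (μ : Measure (cmDatum L N H).automorphicQuotient) [(cmDatum L N H).IsAutomorphicMeasure μ]
    -- the ALL-CLASSES riders
    (hadm : ∀ (c : ConjClasses (cmDatum L N H).Rational) v,
      mG v (ConjClasses.mk ((cmDatum L N H).toLocal v ((cmDatum L N H).toAdelic (Quotient.out c)))) ≠ 0 ∧
      SMulInvariantMeasure ((cmDatum L N H).Local v) _ (mG v (ConjClasses.mk ((cmDatum L N H).toLocal v ((cmDatum L N H).toAdelic (Quotient.out c))))) ∧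
      IsFiniteMeasureOnCompacts (mG v (ConjClasses.mk ((cmDatum L N H).toLocal v ((cmDatum L N H).toAdelic (Quotient.out c))))))
    (hadmA' : ∀ c : ConjClasses (cmDatum L N H).Rational,
      mGi (ConjClasses.mk (archPart (↥(maximalRealSubfield L)) L (IsCMField.complexConj L) N H ((cmDatum L N H).toAdelic (Quotient.out c)))) ≠ 0 ∧
      SMulInvariantMeasure (arch (↥(maximalRealSubfield L)) L (IsCMField.complexConj L) N H) _
        (mGi (ConjClasses.mk (archPart (↥(maximalRealSubfield L)) L (IsCMField.complexConj L) N H ((cmDatum L N H).toAdelic (Quotient.out c))))) ∧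
      IsFiniteMeasureOnCompacts (mGi (ConjClasses.mk (archPart (↥(maximalRealSubfield L)) L (IsCMField.complexConj L) N H ((cmDatum L N H).toAdelic (Quotient.out c))))))
    (hnorm : ∀ c : ConjClasses (cmDatum L N H).Rational, ∃ S₀ : Finset (HeightOneSpectrum (𝓞 ↥(maximalRealSubfield L))),
      IsNormalisedOff L N H mG ((cmDatum L N H).toAdelic (Quotient.out c)) S₀)
    -- the stability letter at the NON-regular classes (K7 for transfer-compatible members; see the module docstring)
    (hstab_s : ∀ (νZ : ∀ c : ConjClasses (cmDatum L N H).Rational,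
        Measure ↥(Subgroup.centralizer ({(cmDatum L N H).toAdelic (Quotient.out c)} : Set (cmDatum L N H).Adelic)))
      (_ : ∀ c, IsHaarMeasure (νZ c)) (_ : ∀ c, (νZ c).IsMulRightInvariant) (_ : ∀ c, (νZ c).IsInvInvariant),
      (∀ c, AdelicOrbitalMeasureFamily.ofLocal L N H mG mGi c =
        quotientMeasure (Subgroup.centralizer ({(cmDatum L N H).toAdelic (Quotient.out c)} : Set (cmDatum L N H).Adelic)) (νZ c) (hCcl _) νA) →
      ∀ c c' : ConjClasses (cmDatum L N H).Rational, ¬ IsRegularElt ((Quotient.out c).val : GL (Fin N) L) →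
        StableClass.ofConjClass c = StableClass.ofConjClass c' →
        quotientMeasure (((cmDatum L N H).quotientSubgroup ⊓
            Subgroup.centralizer ({(cmDatum L N H).toAdelic (Quotient.out c)} : Set (cmDatum L N H).Adelic)).subgroupOf
            (Subgroup.centralizer ({(cmDatum L N H).toAdelic (Quotient.out c)} : Set (cmDatum L N H).Adelic))) count
            (isClosed_subgroupOf _ _ ((isClosed_cmDatum_quotientSubgroup L N H).inter (hCcl _))) (νZ c) Set.univ =
          quotientMeasure (((cmDatum L N H).quotientSubgroup ⊓
            Subgroup.centralizer ({(cmDatum L N H).toAdelic (Quotient.out c')} : Set (cmDatum L N H).Adelic)).subgroupOf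
            (Subgroup.centralizer ({(cmDatum L N H).toAdelic (Quotient.out c')} : Set (cmDatum L N H).Adelic))) count
            (isClosed_subgroupOf _ _ ((isClosed_cmDatum_quotientSubgroup L N H).inter (hCcl _))) (νZ c') Set.univ) :
    ∃ μA : AdelicOrbitalMeasureFamily L N H,
      (∀ c : ConjClasses (cmDatum L N H).Rational,
          SMulInvariantMeasure (cmDatum L N H).Adelic _ (μA c) ∧ IsFiniteMeasureOnCompacts (μA c) ∧ μA c ≠ 0) ∧
      (∀ F : C_c((cmDatum L N H).Adelic, ℂ), (Function.support (adelicClassOrbitalIntegral L N H μA F)).Finite) ∧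
      (∀ F : C_c((cmDatum L N H).Adelic, ℂ), diagTrace L N H μ νA hanis F =
        ∑ᶠ st : StableClass (cmConjRingHom L) H, st.orbitalSum (adelicClassOrbitalIntegral L N H μA F)) ∧
      ∃ α : StableClass (cmConjRingHom L) H → ℝ, (∀ 𝒪, 0 < α 𝒪) ∧
        ∀ c : ConjClasses (cmDatum L N H).Rational,
          μA c = ENNReal.ofReal (α (StableClass.ofConjClass c)) • AdelicOrbitalMeasureFamily.ofLocal L N H mG mGi c := by
  -- `m := ofLocal mG mGi` is admissible at EVERY class (★ `ofLocal_admissible`)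
  have hadmO : ∀ c : ConjClasses (cmDatum L N H).Rational,
      SMulInvariantMeasure (cmDatum L N H).Adelic _ (AdelicOrbitalMeasureFamily.ofLocal L N H mG mGi c) ∧
        IsFiniteMeasureOnCompacts (AdelicOrbitalMeasureFamily.ofLocal L N H mG mGi c) ∧
        AdelicOrbitalMeasureFamily.ofLocal L N H mG mGi c ≠ 0 := by
    intro c
    obtain ⟨S₀, hS₀⟩ := hnorm c
    exact AdelicOrbitalMeasureFamily.ofLocal_admissible L N H mG mGi c hS₀ (hadm c) (hadmA' c)
  -- ★ (c5) at `R := ⊤`, its stability hypothesis by cases on regularity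
  obtain ⟨μA, hμA, hsupp, hθ, α, hα, hw⟩ := exists_absorbedFamily_stableCovolWeight L N H νA μ hanis
    (AdelicOrbitalMeasureFamily.ofLocal L N H mG mGi) hadmO (fun _ => True) (by
      intro νZ hνZ hr hi hm c c' _ _ hst
      by_cases hc : IsRegularElt ((Quotient.out c).val : GL (Fin N) L)
      · -- regular pair: the (c4) HEAD (regularity passes to `c′` along stable conjugacy)
        have hc' : IsRegularElt ((Quotient.out c').val : GL (Fin N) L) :=
          isRegularElt_of_isConj (StableClass.ofConjClass_eq_ofConjClass_iff_isStablyConj_out.mp hst) hc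
        haveI := hνZ; haveI := hr; haveI := hi
        exact covol_ofLocal_eq_of_isRegular_of_ofConjClass_eq L N H hanis hH hHd ν hK mG hcan mGi νGi t' hW hC hadmA νA
          (AdelicOrbitalMeasureFamily.ofLocal L N H mG mGi) (fun _ _ => rfl) νZ hm c c' hc hc' hst
      · -- non-regular pair: the letter
        exact hstab_s νZ hνZ hr hi hm c c' hc hst)
  exact ⟨μA, hμA, hsupp, hθ, α, hα, fun c => hw c trivial⟩

end Head

end UnitaryGroup

end Literature.NumberTheory.Automorphic
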